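import Literature.RepresentationTheory.HeisenbergGroup.LeraySectionStabiliserAgreement
import HarnessLib

/-!
# The unipotent value of a Leray section in a Gram model: `r(n(c)) = unipOpPi (c ·)`

Topic `RepresentationTheory/HeisenbergGroup`; namespace `Literature.RepresentationTheory.HeisenbergGroup`. KERNEL
mathematics only (theorems; no definition, no named fact, no `axiom`, no `sorry`). The UNIPOTENT twin of ★
`LeraySectionStabiliserAgreement` §3 (`leraySection_apply_transportSp_levi`, the Levi value).

Let `F` be a non-archimedean local field of characteristic `0`, `ψ` continuous non-trivial, `ρ_T = schrodingerSB β_T ψ` the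
Schrödinger model of a Gram duality `β_T(x, y) = ⟨x, T y⟩` (`det T` a unit) on `𝒮(F^ι)`, and `r` THE normalised section of
implementers whose multiplier is the Leray cocycle `c^{ψ(½·)}_{ℓ_Y}` of `ℓ_Y = 0 ⊕ F^ι` ([Rangarao1993] Thm 4.1). For `c ∈ M_ι(F)`
symmetric let `n(c) := transportSp T (low c)` be the transported Siegel unipotent (`low c = [[1, 0], [c, 1]]` in Mathlib's matrix
symplectic group; under the transport `(x, y) ↦ (x, T y)` it is weil-1's `(x, y) ↦ (x, y + T⁻¹ c x)`, ★ `transportSp_low`).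

* §1 `n(c)` fixes `ℓ_Y` (`map_transportSp_low_prod_bot_top`) and acts on it as the identity, so `det (n(c)|_{ℓ_Y}) = 1`
  (`det_restrict_transportSp_low`); the second-degree function of `n(c)` in the Gram model is Rao's `½⟨x, c x⟩`
  (`half_toLinearMap₂'_lowLin_eq_halfForm`), so the tree's `unipOpPi hl (c ·)` — multiplication by `ψ(-½⟨x, c x⟩)` — implements
  `n(c)` in `ρ_T` (`implements_transportSp_low_unipOpPi`, ★ `unipotent_mem_MpPsi`).
* §2 **`r(n(c)) = unipOpPi hl (c ·)`** (`leraySection_apply_transportSp_low`): both operators implement `n(c)`, so they differ by a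
  scalar (`ImplementerUniqueUpToScalar`), which is `1` by the value at the origin `(r(n(c))Φ)(0) = |det(n(c)|_{ℓ_Y})|^{1/2} Φ(0) = Φ(0)`
  (★ `apply_zero_conj_eq_gram`) against `(unipOpPi … Φ)(0) = ψ(0) Φ(0) = Φ(0)`.

Written for the soft road (π3) of the Hodge-CM cell `hodgecm-mathlib` (line LD2, brick (J1a) «unipotent operator twin»; consumer: the
`Δ`-functional model junction of [Kudla1994, Thm 3.1]'s splitting, sequel `GelbartRogawski1991/LocalDoubledLeraySectionSiegelUnipotent`);
nothing here is specific to unitary groups. HC_CM is proved only modulo the printed citations (2 remaining named inputs hLiu418,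
h413) until rung 0 closes; count-neutral.

## References
* R. Ranga Rao, *On some explicit formulas in the theory of Weil representation*, Pacific J. Math. 157 (1993) 335–371: Lemma 3.2
  (3.8) p. 351, Thm 3.5 p. 355, Thm 4.1 p. 358 [Rangarao1993].
* C. Mœglin, M.-F. Vignéras, J.-L. Waldspurger, *Correspondances de Howe sur un corps p-adique*, LNM 1291 (1987), Chap. 2 II.2, II.6
  [MoeglinVignerasWaldspurger1987].
* A. Weil, *Sur certains groupes d'opérateurs unitaires*, Acta Math. 111 (1964), n° 6 p. 151, n° 13 p. 160 [Weil1964].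
-/

set_option autoImplicit false

noncomputable section

namespace Literature.RepresentationTheory.HeisenbergGroup

open _root_.MeasureTheory Matrix
open Literature.GroupTheory Literature.NumberTheory.Automorphic
open Literature.NumberTheory.GaloisRepresentations.IsNonarchimedeanLocalField
open Literature.NumberTheory.Weil1964 Literature.LinearAlgebra.QuadraticForm
open SymplecticMatrix

section Gram

variable {F : Type*} [Field F] [ValuativeRel F] [TopologicalSpace F] [IsNonarchimedeanLocalField F] [CharZero F]
  {ι : Type*} [Fintype ι] [DecidableEq ι] [Invertible (2 : F)] (T : Matrix ι ι F) (hT : IsUnit T.det)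
  {ψ : AddChar F Circle} (hl : IsLocallyConstant (⇑ψ : F → Circle))
  (hbT : ∀ y : ι → F, Continuous fun u : ι → F => Matrix.toLinearMap₂' F T u y)
  [MeasurableSpace F] [BorelSpace F] (μ : Measure F) [μ.IsAddHaarMeasure]

/-! ## §1 `n(c)` fixes `ℓ_Y`, acts trivially on it, and is implemented by `unipOpPi (c ·)` -/

omit [ValuativeRel F] [TopologicalSpace F] [IsNonarchimedeanLocalField F] [CharZero F] [MeasurableSpace F] [BorelSpace F] in
/-- `n(c) = transportSp T (low c)` fixes `ℓ_Y = 0 ⊕ F^ι`. [cite: Rangarao1993, §2.2, p. 338; Weil1964, n° 7, p. 152] -/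
theorem map_transportSp_low_prod_bot_top (c : Matrix ι ι F) (hc : c.IsSymm) :
    Submodule.map (((transportSp T hT (low c hc) : symplecticGroup (polar (Matrix.toLinearMap₂' F T))) :
        ((ι → F) × (ι → F)) ≃ₗ[F] ((ι → F) × (ι → F))) : ((ι → F) × (ι → F)) →ₗ[F] ((ι → F) × (ι → F)))
      (Submodule.prod (⊥ : Submodule F (ι → F)) (⊤ : Submodule F (ι → F))) =
      Submodule.prod (⊥ : Submodule F (ι → F)) (⊤ : Submodule F (ι → F)) :=
  map_prod_bot_top_eq_of _ fun v => by rw [transportSp_low T hT c hc, coe_unipotentSp, unipotentσ_apply]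

omit [ValuativeRel F] [TopologicalSpace F] [IsNonarchimedeanLocalField F] [CharZero F] [MeasurableSpace F] [BorelSpace F] in
/-- **`det (n(c)|_{ℓ_Y}) = 1`**: the unipotent `(x, y) ↦ (x, y + T⁻¹ c x)` is the identity on `ℓ_Y = {x = 0}`.
[cite: Rangarao1993, Lemma 3.2 (1), p. 351] -/
theorem det_restrict_transportSp_low (c : Matrix ι ι F) (hc : c.IsSymm)
    (hg : Submodule.map (((transportSp T hT (low c hc) : symplecticGroup (polar (Matrix.toLinearMap₂' F T))) :
        ((ι → F) × (ι → F)) ≃ₗ[F] ((ι → F) × (ι → F))) : ((ι → F) × (ι → F)) →ₗ[F] ((ι → F) × (ι → F)))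
      (Submodule.prod (⊥ : Submodule F (ι → F)) (⊤ : Submodule F (ι → F))) =
      Submodule.prod (⊥ : Submodule F (ι → F)) (⊤ : Submodule F (ι → F))) :
    LinearMap.det
      ((((transportSp T hT (low c hc) : symplecticGroup (polar (Matrix.toLinearMap₂' F T))) :
        ((ι → F) × (ι → F)) ≃ₗ[F] ((ι → F) × (ι → F))) : ((ι → F) × (ι → F)) →ₗ[F] ((ι → F) × (ι → F))).restrict
        (p := Submodule.prod (⊥ : Submodule F (ι → F)) (⊤ : Submodule F (ι → F)))
        (q := Submodule.prod (⊥ : Submodule F (ι → F)) (⊤ : Submodule F (ι → F)))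
        fun _ hx => hg.le (Submodule.mem_map_of_mem hx)) = 1 := by
  have hid : ((((transportSp T hT (low c hc) : symplecticGroup (polar (Matrix.toLinearMap₂' F T))) :
        ((ι → F) × (ι → F)) ≃ₗ[F] ((ι → F) × (ι → F))) : ((ι → F) × (ι → F)) →ₗ[F] ((ι → F) × (ι → F))).restrict
        (p := Submodule.prod (⊥ : Submodule F (ι → F)) (⊤ : Submodule F (ι → F)))
        (q := Submodule.prod (⊥ : Submodule F (ι → F)) (⊤ : Submodule F (ι → F)))
        fun _ hx => hg.le (Submodule.mem_map_of_mem hx)) = LinearMap.id := by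
    apply LinearMap.ext
    intro p
    apply Subtype.ext
    have hp : (p : ((ι → F) × (ι → F))).1 = 0 := (mem_prod_bot_top_iff _).1 p.2
    rw [LinearMap.coe_restrict_apply, LinearMap.id_apply]
    change ((transportSp T hT (low c hc) : symplecticGroup (polar (Matrix.toLinearMap₂' F T))) :
      ((ι → F) × (ι → F)) ≃ₗ[F] ((ι → F) × (ι → F))) (p : ((ι → F) × (ι → F))) = (p : ((ι → F) × (ι → F)))
    rw [transportSp_low T hT c hc, coe_unipotentSp, unipotentσ_apply, hp, map_zero, add_zero]
    exact Prod.ext hp.symm rfl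
  rw [hid, LinearMap.det_id]

omit [ValuativeRel F] [TopologicalSpace F] [IsNonarchimedeanLocalField F] [CharZero F] [MeasurableSpace F] [BorelSpace F] in
include hT in
/-- the second-degree function of `n(c)` in the Gram model is Rao's `½⟨x, c x⟩`: `½ β_T(x, T⁻¹ c x) = halfForm (c ·) x`.
[cite: Rangarao1993, Lemma 3.2 (3.8), p. 351] -/
theorem half_toLinearMap₂'_lowLin_eq_halfForm (c : Matrix ι ι F) :
    (fun x : ι → F => ⅟(2 : F) * Matrix.toLinearMap₂' F T x (lowLin T c x)) = halfForm (Matrix.mulVecLin c) := by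
  funext x
  rw [halfForm, Matrix.toLinearMap₂'_apply', lowLin_apply, Matrix.mulVec_mulVec, Matrix.mul_nonsing_inv_cancel_left T _ hT,
    dotProductBilin_apply_apply, Matrix.mulVecLin_apply]

omit [CharZero F] [MeasurableSpace F] [BorelSpace F] in
/-- **`unipOpPi hl (c ·)` implements `n(c) = transportSp T (low c)` in the Gram model `ρ_T`** (★ `unipotent_mem_MpPsi` at the
weil-1 unipotent `(x, y) ↦ (x, y + T⁻¹ c x)`, whose second-degree function is `½⟨x, c x⟩`).
[cite: MoeglinVignerasWaldspurger1987, Chap. 2 II.6; Rangarao1993, Lemma 3.2 (3.8), p. 351] -/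
theorem implements_transportSp_low_unipOpPi (c : Matrix ι ι F) (hc : c.IsSymm) :
    Implements (schrodingerSB (Matrix.toLinearMap₂' F T) ψ hl hbT) (ofSymplectic _ (transportSp T hT (low c hc)))
      (unipOpPi hl (Matrix.mulVecLin c)) := by
  have hq : Continuous fun x : ι → F => ⅟(2 : F) * Matrix.toLinearMap₂' F T x (lowLin T c x) := by
    rw [half_toLinearMap₂'_lowLin_eq_halfForm T hT c]
    exact continuous_halfForm _
  have h := (mem_MpPsi (schrodingerSB (Matrix.toLinearMap₂' F T) ψ hl hbT) _).1
    (unipotent_mem_MpPsi (Matrix.toLinearMap₂' F T) ψ hl hbT (lowLin T c) (lowLin_symm T hT c hc) hq)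
  have e : ∀ {q : (ι → F) → F} (hq' : Continuous q), q = halfForm (Matrix.mulVecLin c) →
      unipotentEquivSB ψ hl q hq' = unipOpPi hl (Matrix.mulVecLin c) := by
    rintro q hq' rfl
    rfl
  rw [transportSp_low T hT c hc, ← e hq (half_toLinearMap₂'_lowLin_eq_halfForm T hT c)]
  exact h

/-! ## §2 The unipotent value of a Leray section in a Gram model -/

/-- **THE UNIPOTENT VALUE OF A LERAY SECTION IN A GRAM MODEL.** For `ρ_T = schrodingerSB β_T ψ` (`det T` a unit) and `r` THE
normalised section of implementers whose multiplier is the Leray cocycle `c^{ψ(½·)}_{ℓ_Y}` of `ℓ_Y = 0 ⊕ F^ι`, the value on the transported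
Siegel unipotent `n(c) = transportSp T (low c)` (`c` symmetric) is the tree's unipotent operator: `r(n(c)) = unipOpPi hl (c ·)`, i.e.
`(r(n(c)) Φ)(x) = ψ(-½⟨x, c x⟩) Φ(x)` — both implement `n(c)`, so they differ by a scalar, which is `1` by the value at the origin
`(r(n(c)) Φ)(0) = |det(n(c)|_{ℓ_Y})|^{1/2} Φ(0) = Φ(0)`.
[cite: Rangarao1993, Lemma 3.2 (3.8), p. 351, Thm 3.5 (3), p. 355, Thm 4.1, p. 358; MoeglinVignerasWaldspurger1987, Chap. 2 II.6] -/
theorem leraySection_apply_transportSp_low (hψ : ψ.IsContinuousNontrivial)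
    (hU : ImplementerUniqueUpToScalar (schrodingerSB (Matrix.toLinearMap₂' F T) ψ hl hbT))
    (r : ImplementerSection (schrodingerSB (Matrix.toLinearMap₂' F T) ψ hl hbT))
    (hY : LinearMap.BilinForm.orthogonal (alt (polar (Matrix.toLinearMap₂' F T)))
      (Submodule.prod (⊥ : Submodule F (ι → F)) (⊤ : Submodule F (ι → F))) =
      Submodule.prod (⊥ : Submodule F (ι → F)) (⊤ : Submodule F (ι → F)))
    (hr : r.cocycle hU = lerayCentralCocycle μ (isContinuousNontrivial_mulShift_half hψ) (isAlt_alt_polar_gram T)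
      (nondegenerate_alt_polar_gram T hT) hY)
    (c : Matrix ι ι F) (hc : c.IsSymm) : r (transportSp T hT (low c hc)) = unipOpPi hl (Matrix.mulVecLin c) := by
  -- the two implementers of `n(c)` differ by a scalar `s`
  obtain ⟨s, hs⟩ := hU _ (unipOpPi hl (Matrix.mulVecLin c)) (r (transportSp T hT (low c hc)))
    (implements_transportSp_low_unipOpPi T hT hl hbT c hc) (r.implements _)
  -- a test function with `Φ₀(0) = 1`
  set Φ₀ : SchwartzBruhat (ι → F) :=
    ⟨(piPrimePowBall F ι 0).indicator fun _ => (1 : ℂ), indicator_piPrimePowBall_mem_schwartzBruhat 0 1⟩ with hΦ₀_def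
  have hΦ₀ : (Φ₀ : (ι → F) → ℂ) 0 = 1 := by
    rw [hΦ₀_def]
    exact Set.indicator_of_mem (zero_mem_piPrimePowBall (F := F) (ι := ι) 0) (fun _ => (1 : ℂ))
  -- value at the origin: `s · ψ(0) · 1 = |det (n(c)|_{ℓ_Y})|^{1/2} · 1 = 1`
  have hg := map_transportSp_low_prod_bot_top T hT c hc
  have h1 : Submodule.map ((((1 : symplecticGroup (polar (Matrix.toLinearMap₂' F T))) :
      symplecticGroup (polar (Matrix.toLinearMap₂' F T))) : ((ι → F) × (ι → F)) ≃ₗ[F] ((ι → F) × (ι → F))) :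
        ((ι → F) × (ι → F)) →ₗ[F] ((ι → F) × (ι → F)))
      (Submodule.prod (⊥ : Submodule F (ι → F)) (⊤ : Submodule F (ι → F))) =
      Submodule.prod (⊥ : Submodule F (ι → F)) (⊤ : Submodule F (ι → F)) := by
    rw [OneMemClass.coe_one, LinearEquiv.coe_toLinearMap_one, Submodule.map_id]
  have key := apply_zero_conj_eq_gram T hT hl hbT μ hψ hU r hY hr 1 h1 (transportSp T hT (low c hc)) hg Φ₀
  rw [r.map_one, inv_one, mul_one, one_mul, hs Φ₀, Submodule.coe_smul, Pi.smul_apply, smul_eq_mul,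
    coe_unipOpPi_apply, hΦ₀, mul_one, det_restrict_transportSp_low T hT c hc hg, map_one, NNReal.coe_one, Real.sqrt_one,
    Complex.ofReal_one, one_mul] at key
  -- `ψ(-½⟨0, c 0⟩) = ψ 0 = 1`
  have hψ0 : ((ψ (-halfForm (Matrix.mulVecLin c) 0) : Circle) : ℂ) = 1 := by
    simp only [halfForm, map_zero, mul_zero, neg_zero, AddChar.map_zero_eq_one, Circle.coe_one]
  rw [hψ0, mul_one] at key
  have hs1 : (s : ℂ) = 1 := key
  refine LinearEquiv.ext fun f => ?_
  rw [hs f, hs1, one_smul]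

end Gram

end Literature.RepresentationTheory.HeisenbergGroup

end
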